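import Summits.FinalStateConjecture.FinalStateConjecture.Statement
import Summits.FinalStateConjecture.FinalStateConjecture.Theorems.SoloBlindEnvelope

/-!
# Level sets of fibrewise strictly increasing functions are continuous graphs

Solo-blind programme on `FinalStateConjecture`, negative direction (bag-of-gold data), Note B §B13.4
("wall spheres").  In the future-set argument for Case B the excision wall `𝒲_κ ≅ ℝ × S²` of the flat chart
carries the restriction `F` of a temporal function; `F` is continuous, strictly increasing along each timelike
generator `{·} × {θ}`, small on the bottom rim and unbounded above.  The elementary fact recorded here is that
every late level set `{F = c}` is then the GRAPH of a continuous function `S² → ℝ`, hence an embedded copy of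
the base (a 2-sphere), with `{F > c}` the open region above the graph.  No differentiability and no Morse
theory are needed.

The statement is fully abstract (`Y` any topological space) and is obtained as a corollary of the boundary-
function theorem for open future sets, `soloBlind_exists_boundaryFunction` (Theorems/SoloBlindEnvelope.lean),
applied to the superlevel set `{F > c}` with the preorder `F p ≤ F q` as the abstract causal relation; this
also documents a second use of that theorem.

References: B. O'Neill, Semi-Riemannian Geometry, Academic Press 1983, Ch. 14 (temporal functions increase
strictly along future timelike curves) — used only as motivation; the file is pure topology.
-/

noncomputable section

open Set Filter
open scoped Topology

set_option linter.dupNamespace false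

namespace Summit.FinalStateConjecture.FinalStateConjecture.Theorems

section LevelGraph

variable {Y : Type*} [TopologicalSpace Y]

/-- **Level sets of fibrewise strictly increasing functions are graphs.**  Let `F : ℝ × Y → ℝ` be
continuous and strictly increasing in the real variable on every fibre, and let `c` be a value that every
fibre passes: somewhere `F ≤ c` and somewhere `c < F`.  Then there is a continuous `g : Y → ℝ` such that the
superlevel set `{c < F}` is exactly the open region `{g y < σ}` above the graph of `g`, and `F (g y, y) = c`
for every `y`. -/
theorem soloBlind_exists_levelFunction (F : ℝ × Y → ℝ) (hF : Continuous F)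
    (hmono : ∀ y : Y, StrictMono fun σ : ℝ => F (σ, y)) (c : ℝ)
    (hlo : ∀ y : Y, ∃ σ : ℝ, F (σ, y) ≤ c) (hhi : ∀ y : Y, ∃ σ : ℝ, c < F (σ, y)) :
    ∃ g : Y → ℝ, Continuous g ∧ (∀ (σ : ℝ) (y : Y), c < F (σ, y) ↔ g y < σ) ∧
      ∀ y : Y, F (g y, y) = c := by
  -- the superlevel set is an open future set for the preorder `F p ≤ F q`
  have hA : IsOpen {p : ℝ × Y | c < F p} := isOpen_lt continuous_const hF
  have hfut : ∀ p q : ℝ × Y, F p ≤ F q → p ∈ {p : ℝ × Y | c < F p} → q ∈ {p : ℝ × Y | c < F p} :=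
    fun p q hpq hp => lt_of_lt_of_le hp hpq
  have hcone : ∀ (y : Y) (σ σ' : ℝ), σ < σ' → ∀ᶠ y' in 𝓝 y, F (σ, y') ≤ F (σ', y) := by
    intro y σ σ' hσ
    have hc : Continuous fun y' : Y => F (σ, y') := hF.comp (Continuous.prodMk continuous_const continuous_id)
    have hlt : ∀ᶠ y' in 𝓝 y, F (σ, y') < F (σ', y) :=
      (hc.tendsto y).eventually_lt tendsto_const_nhds (hmono y hσ)
    exact hlt.mono fun y' h => h.le
  have hmeet : ∀ y : Y, ∃ σ : ℝ, (σ, y) ∈ {p : ℝ × Y | c < F p} := hhi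
  have hmiss : ∀ y : Y, ∃ σ : ℝ, (σ, y) ∉ {p : ℝ × Y | c < F p} := by
    intro y
    obtain ⟨σ, hσ⟩ := hlo y
    exact ⟨σ, fun h => absurd (lt_of_lt_of_le h hσ) (lt_irrefl c)⟩
  obtain ⟨g, hg, hiff⟩ := soloBlind_exists_boundaryFunction hA hfut hcone hmeet hmiss
  refine ⟨g, hg, fun σ y => hiff σ y, fun y => ?_⟩
  -- at the graph: not above, so `F ≤ c`; approached from above by points with `c < F`, so `c ≤ F`
  have hle : F (g y, y) ≤ c := by
    by_contra h
    exact lt_irrefl (g y) ((hiff (g y) y).mp (lt_of_not_ge h))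
  have hge : c ≤ F (g y, y) := by
    have hcts : Continuous fun σ : ℝ => F (σ, y) := hF.comp (Continuous.prodMk continuous_id continuous_const)
    have htend : Tendsto (fun σ : ℝ => F (σ, y)) (𝓝[>] g y) (𝓝 (F (g y, y))) :=
      (hcts.tendsto (g y)).mono_left nhdsWithin_le_nhds
    refine ge_of_tendsto htend ?_
    refine eventually_nhdsWithin_of_forall fun σ hσ => ?_
    exact ((hiff σ y).mpr hσ).le
  exact le_antisymm hle hge

omit [TopologicalSpace Y] in
/-- Uniqueness of the level point on each fibre: with `g` as in `soloBlind_exists_levelFunction`,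
`F (σ, y) = c` holds exactly at `σ = g y`. -/
theorem soloBlind_level_eq_iff {F : ℝ × Y → ℝ} (hmono : ∀ y : Y, StrictMono fun σ : ℝ => F (σ, y))
    {c : ℝ} {g : Y → ℝ} (hg : ∀ y : Y, F (g y, y) = c) (σ : ℝ) (y : Y) :
    F (σ, y) = c ↔ σ = g y := by
  constructor
  · intro h
    have h' : F (σ, y) = F (g y, y) := by rw [h, hg y]
    exact (hmono y).injective h'
  · rintro rfl
    exact hg y

omit [TopologicalSpace Y] in
/-- The level set is the graph of `g`, i.e. the range of `y ↦ (g y, y)`; in particular it is homeomorphic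
to the base `Y` via the second projection (for the wall of an excision tube: an embedded 2-sphere). -/
theorem soloBlind_levelSet_eq_range {F : ℝ × Y → ℝ} (hmono : ∀ y : Y, StrictMono fun σ : ℝ => F (σ, y))
    {c : ℝ} {g : Y → ℝ} (hg : ∀ y : Y, F (g y, y) = c) :
    {p : ℝ × Y | F p = c} = Set.range fun y : Y => (g y, y) := by
  ext ⟨σ, y⟩
  simp only [Set.mem_setOf_eq, Set.mem_range, Prod.mk.injEq]
  constructor
  · intro h
    exact ⟨y, ((soloBlind_level_eq_iff hmono hg σ y).mp h).symm, rfl⟩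
  · rintro ⟨y', hy', rfl⟩
    rw [← hy']
    exact hg y'

omit [TopologicalSpace Y] in
/-- The sublevel side: with `g` as above, `F (σ, y) < c` exactly when `σ < g y` (the open region below the
graph); together with `soloBlind_exists_levelFunction` this splits `ℝ × Y` into below / on / above the graph. -/
theorem soloBlind_lt_level_iff {F : ℝ × Y → ℝ} (hmono : ∀ y : Y, StrictMono fun σ : ℝ => F (σ, y))
    {c : ℝ} {g : Y → ℝ} (hg : ∀ y : Y, F (g y, y) = c) (σ : ℝ) (y : Y) :
    F (σ, y) < c ↔ σ < g y := by
  rw [← hg y]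
  exact (hmono y).lt_iff_lt

/-- The graph map `y ↦ (g y, y)` of a continuous level function is a topological embedding onto the level
set, so the level set is homeomorphic to the base. -/
theorem soloBlind_isEmbedding_levelGraph {g : Y → ℝ} (hg : Continuous g) :
    Topology.IsEmbedding fun y : Y => (g y, y) :=
  Topology.IsEmbedding.of_comp (hg.prodMk continuous_id) continuous_snd Topology.IsEmbedding.id

end LevelGraph

end Summit.FinalStateConjecture.FinalStateConjecture.Theorems
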